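import Summits.AtomisticToContinuum.FouriersLaw.Theorems.PhononMeanFreePathIncoherentChannelForecastLossHarmonic
import Summits.AtomisticToContinuum.FouriersLaw.Theorems.PhononMeanFreePathIncoherentChannelTwoHorizonsCrux
import Summits.AtomisticToContinuum.FouriersLaw.Theorems.PhononMeanFreePathBoundaryKubo
import Summits.AtomisticToContinuum.FouriersLaw.Theorems.IncoherentChannel.Negative.LoadBearing

/-!
# The WEAKEST engine the line's composition accepts: an integrated forecast TAIL beyond the causal window

Route `PhononMeanFreePath` (sub-problem `FouriersLaw`), crux `IncoherentChannel` (stmt-AtomisticToContinuum-11811), line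
`two-horizons-forecast-loss`, lead c3; census file (`--supports`), nothing here closes an item.

The registered ENGINE stub of the line is the pointwise envelope `stub_forecastLoss : S_N(t) ≤ C(1+t)^{−α}`, `α > 2`,
for ALL `N, t ≥ 0` (`S_N = fnorm`, the forecast norm of the bath momentum). The composition (`twoHorizons_meanChannels`)
uses it only (a) BEYOND the causal window `t ≥ N^η` and (b) after TIME INTEGRATION against the weight `N`. This
file records the weakest hypothesis of that shape which still runs the composition — the FORECAST TAIL at one
parameter point,

  `FT(ω₂,lam,β,γ,T) :  ∃ θ, η ∈ (0,1),  (∀ N, S_N^θ ∈ L¹(0,∞))  ∧  N · ∫_{t > N^η} S_N(t)^θ dt → 0`,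

written out in each signature (no definition is introduced):

* `forecastTailAt_meanChannels` — at every coupling `lam, β, γ ≥ 0`: `FT` + the landed causality window
  (`lightConeH_of_nonneg`) + the landed fixed-`N` dictionary (`forecastLossH_commonPastBound_of_nonneg`) give
  integrability of `P_N − 2r_N²` and `r_N²` on `(0,∞)` at every `N` and `N∫₀^∞(P_N − 2r_N²) → 0`, `N∫₀^∞ r_N² → 0`
  (window: `N^{1+η}ε_N → 0`; tail: `|P_N − 2r_N²| ≤ (K⁺ + 2T^{2−θ})·S_N^θ`, `r_N² ≤ T^{2−θ}S_N^θ` since `S_N ≤ T`);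
* `forecastTailAt_of_forecastEnvelopeAt` — the registered envelope implies `FT` (θ = η = (α+2)/(2α)), so everything
  proved from the envelope factors through `FT`;
* `coherentDephasing_of_forecastTail`, `incoherentChannel_of_forecastTail_of_varianceLimit`,
  `incoherentChannel_iff_fouriersLaw_of_forecastTail` — the line's three compositions re-based on `FT`;
* `forecastTail_false_harmonic` — `FT` is still FALSE at the harmonic corner `lam = β = 0` (it would close the
  coherent channel there, against `HarmonicCoherentPersistence`): the weakening does not cross the harmonic
  obstruction, i.e. anharmonicity remains load-bearing exactly at the engine.

Reading: what the crux line needs from bulk chaos is not a decay LAW of `S_N` but only that `N` times the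
`θ`-tail mass of the forecast norm beyond ANY sub-ballistic window `N^η` vanishes — e.g. any bound
`S_N(t) ≤ C (N^a/t)^b` on `t ≥ N^η` with `bθ > 1` and `1 + a b θ + η(1 − bθ) < 0` would do, as would fixed-`N` mixing
at rate `≳ N^{−k}` combined with window-edge smallness `S_N(N^η)^θ ≪ N^{−1−k}`.
No definition, no `sorry`, axioms standard.
-/

noncomputable section

open MeasureTheory Set Filter Topology
open scoped NNReal

namespace Summit.AtomisticToContinuum.FouriersLaw.Theorems.PhononMeanFreePath

open Literature.MathematicalPhysics.KineticTheory.HeatConduction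
open Summit.AtomisticToContinuum.FouriersLaw.Theses.PhononMeanFreePath (IncoherentChannel CoherentDephasing NessUnique_holds)

/-! ## The composition from the tail, at one parameter point (every coupling `lam, β, γ ≥ 0`) -/

/-- `S ≤ T^{1−θ}·S^θ` for `0 ≤ S ≤ T` and `θ ≤ 1`. [folklore] -/
theorem le_rpow_mul_rpow_of_le {S T θ : ℝ} (hS : 0 ≤ S) (hST : S ≤ T) (hθ1 : θ ≤ 1) :
    S ≤ T ^ (1 - θ) * S ^ θ := by
  rcases eq_or_lt_of_le hS with h | h
  · rw [← h]
    exact mul_nonneg (Real.rpow_nonneg (hS.trans hST) _) (Real.rpow_nonneg le_rfl _)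
  · calc S = S ^ (1 - θ) * S ^ θ := by
          rw [← Real.rpow_add h, show (1 - θ) + θ = 1 by ring, Real.rpow_one]
      _ ≤ T ^ (1 - θ) * S ^ θ :=
          mul_le_mul_of_nonneg_right (Real.rpow_le_rpow hS hST (by linarith)) (Real.rpow_nonneg hS θ)

/-- **The two horizons close the mean channels from the forecast TAIL** (one parameter point, every coupling
`lam, β, γ ≥ 0`): if for some `θ, η ∈ (0,1)` the powers `S_N^θ` are integrable on `(0,∞)` at every `N` and
`N·∫_{t>N^η} S_N^θ → 0`, then `P_N − 2r_N²` and `r_N²` are integrable on `(0,∞)` for every `N` and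
`N·∫₀^∞ (P_N − 2r_N²) → 0`, `N·∫₀^∞ r_N² → 0`. [folklore] -/
theorem forecastTailAt_meanChannels {ω₂ lam β γ T : ℝ} (hω : 0 < ω₂) (hl : 0 ≤ lam) (hβ : 0 ≤ β) (hγ : 0 ≤ γ)
    (hT : 0 < T)
    (htail : ∃ θ η : ℝ, 0 < θ ∧ θ < 1 ∧ 0 < η ∧ η < 1 ∧
      (∀ N : ℕ, IntegrableOn (fun t => (fnorm ω₂ lam β γ T N t) ^ θ) (Ioi (0 : ℝ))) ∧
      Tendsto (fun N : ℕ => (N : ℝ) * ∫ t in Ioi ((N : ℝ) ^ η), (fnorm ω₂ lam β γ T N t) ^ θ) atTop (𝓝 0)) :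
    (∀ N : ℕ, IntegrableOn (fun t => commonPast ω₂ lam β γ T N t - 2 * (pairCorr ω₂ lam β γ T N t) ^ 2)
        (Ioi (0 : ℝ))) ∧
    Tendsto (fun N : ℕ => (N : ℝ) * ∫ t in Ioi (0 : ℝ),
        (commonPast ω₂ lam β γ T N t - 2 * (pairCorr ω₂ lam β γ T N t) ^ 2)) atTop (𝓝 0) ∧
    (∀ N : ℕ, IntegrableOn (fun t => (pairCorr ω₂ lam β γ T N t) ^ 2) (Ioi (0 : ℝ))) ∧
    Tendsto (fun N : ℕ => (N : ℝ) * ∫ t in Ioi (0 : ℝ), (pairCorr ω₂ lam β γ T N t) ^ 2) atTop (𝓝 0) := by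
  obtain ⟨θ, η, hθ0, hθ1, hη0, hη1, hSθint, htl⟩ := htail
  obtain ⟨hmeas, hr2, hPθ⟩ := forecastLossH_commonPastBound_of_nonneg hω hl hβ hγ hT
  obtain ⟨K, hK⟩ := hPθ θ hθ0 hθ1
  obtain ⟨ε, hε, hwin⟩ := lightConeH_of_nonneg ω₂ lam β γ hω hl hβ hγ T hT η hη0 hη1
  -- abbreviations
  set S : ℕ → ℝ → ℝ := fun N t => fnorm ω₂ lam β γ T N t with hSdef
  set P : ℕ → ℝ → ℝ := fun N t => commonPast ω₂ lam β γ T N t with hPdef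
  set r : ℕ → ℝ → ℝ := fun N t => pairCorr ω₂ lam β γ T N t with hrdef
  have hS0 : ∀ N t, 0 ≤ S N t := fun N t => fnorm_nonneg ω₂ lam β γ T N t
  have hST : ∀ N t, S N t ≤ T := fun N t => (commonPastBound_fnorm_le hω hl hβ hγ hT N t).2
  have hSθ0 : ∀ N t, 0 ≤ S N t ^ θ := fun N t => Real.rpow_nonneg (hS0 N t) θ
  -- `S ≤ T^{1-θ} S^θ`
  have hSle : ∀ N t, S N t ≤ T ^ (1 - θ) * S N t ^ θ := fun N t =>
    le_rpow_mul_rpow_of_le (hS0 N t) (hST N t) hθ1.le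
  -- the clipped Hölder constant and the tail constant
  set Kp : ℝ := max K 0 with hKpdef
  have hKp0 : 0 ≤ Kp := le_max_right _ _
  have hT1θ : 0 ≤ T ^ (1 - θ) := Real.rpow_nonneg hT.le _
  set L : ℝ := Kp + 2 * T * T ^ (1 - θ) with hLdef
  have hL0 : 0 ≤ L := by positivity
  -- pointwise bounds by `S^θ`
  have hPbd : ∀ (N : ℕ) (t : ℝ), |P N t| ≤ Kp * S N t ^ θ := by
    intro N t
    calc |P N t| ≤ K * S N t ^ θ := hK N t
      _ ≤ Kp * S N t ^ θ := by gcongr; exacts [hSθ0 N t, le_max_left _ _]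
  have hrbd : ∀ (N : ℕ) (t : ℝ), (r N t) ^ 2 ≤ T * T ^ (1 - θ) * S N t ^ θ := by
    intro N t
    calc (r N t) ^ 2 ≤ T * S N t := hr2 N t
      _ ≤ T * (T ^ (1 - θ) * S N t ^ θ) := by gcongr; exact hSle N t
      _ = T * T ^ (1 - θ) * S N t ^ θ := by ring
  -- the integrands
  set f : ℕ → ℝ → ℝ := fun N t => P N t - 2 * (r N t) ^ 2 with hfdef
  set g : ℕ → ℝ → ℝ := fun N t => (r N t) ^ 2 with hgdef
  have hfmeas : ∀ N, Measurable (f N) := fun N =>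
    (hmeas N).1.sub (((hmeas N).2.pow_const 2).const_mul 2)
  have hgmeas : ∀ N, Measurable (g N) := fun N => (hmeas N).2.pow_const 2
  have hfbd : ∀ (N : ℕ) (t : ℝ), |f N t| ≤ L * S N t ^ θ := by
    intro N t
    have h2 : (0:ℝ) ≤ 2 * (r N t) ^ 2 := by positivity
    calc |f N t| = |P N t - 2 * (r N t) ^ 2| := rfl
      _ ≤ |P N t| + |2 * (r N t) ^ 2| := abs_sub _ _
      _ = |P N t| + 2 * (r N t) ^ 2 := by rw [abs_of_nonneg h2]
      _ ≤ Kp * S N t ^ θ + 2 * (T * T ^ (1 - θ) * S N t ^ θ) := by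
          have := hPbd N t; have := hrbd N t; linarith
      _ = L * S N t ^ θ := by simp only [hLdef]; ring
  have hgbd : ∀ (N : ℕ) (t : ℝ), |g N t| ≤ T * T ^ (1 - θ) * S N t ^ θ := by
    intro N t
    simp only [hgdef, abs_of_nonneg (sq_nonneg (r N t))]
    exact hrbd N t
  -- fixed-N integrability by domination (on `Ioi 0` and on every `Ioi x`)
  have hSθmeas : ∀ N, AEStronglyMeasurable (fun t => S N t ^ θ) (volume.restrict (Ioi (0 : ℝ))) :=
    fun N => (hSθint N).aestronglyMeasurable
  have hfint : ∀ N, IntegrableOn (f N) (Ioi (0 : ℝ)) := by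
    intro N
    refine Integrable.mono' ((hSθint N).const_mul L) (hfmeas N).aestronglyMeasurable ?_
    exact ae_of_all _ fun t => by rw [Real.norm_eq_abs]; exact hfbd N t
  have hgint : ∀ N, IntegrableOn (g N) (Ioi (0 : ℝ)) := by
    intro N
    refine Integrable.mono' ((hSθint N).const_mul (T * T ^ (1 - θ))) (hgmeas N).aestronglyMeasurable ?_
    exact ae_of_all _ fun t => by rw [Real.norm_eq_abs]; exact hgbd N t
  -- the causal window a_N = N^η
  set a : ℕ → ℝ := fun N => (N : ℝ) ^ η with hadef
  have ha0 : ∀ N, 0 ≤ a N := fun N => Real.rpow_nonneg (Nat.cast_nonneg N) η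
  -- tail bounds: N ∫_{Ioi a_N} |f| ≤ L · (N ∫_{Ioi a_N} S^θ), similarly for g
  set τ : ℕ → ℝ := fun N => (N : ℝ) * ∫ t in Ioi (a N), S N t ^ θ with hτdef
  have hτlim : Tendsto τ atTop (𝓝 0) := htl
  have hSθintx : ∀ N, IntegrableOn (fun t => S N t ^ θ) (Ioi (a N)) := fun N =>
    (hSθint N).mono_set (Ioi_subset_Ioi (ha0 N))
  have htailf : ∀ᶠ N : ℕ in atTop, (N : ℝ) * ∫ t in Ioi (a N), |f N t| ≤ L * τ N := by
    refine Eventually.of_forall fun N => ?_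
    have hle : ∫ t in Ioi (a N), |f N t| ≤ ∫ t in Ioi (a N), L * S N t ^ θ :=
      setIntegral_mono_on ((hfint N).mono_set (Ioi_subset_Ioi (ha0 N))).abs ((hSθintx N).const_mul L)
        measurableSet_Ioi (fun t _ => hfbd N t)
    rw [integral_const_mul] at hle
    have hN0 : (0 : ℝ) ≤ N := Nat.cast_nonneg N
    calc (N : ℝ) * ∫ t in Ioi (a N), |f N t| ≤ (N : ℝ) * (L * ∫ t in Ioi (a N), S N t ^ θ) :=
          mul_le_mul_of_nonneg_left hle hN0
      _ = L * τ N := by simp only [hτdef]; ring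
  have htailg : ∀ᶠ N : ℕ in atTop, (N : ℝ) * ∫ t in Ioi (a N), |g N t| ≤ T * T ^ (1 - θ) * τ N := by
    refine Eventually.of_forall fun N => ?_
    have hle : ∫ t in Ioi (a N), |g N t| ≤ ∫ t in Ioi (a N), T * T ^ (1 - θ) * S N t ^ θ :=
      setIntegral_mono_on ((hgint N).mono_set (Ioi_subset_Ioi (ha0 N))).abs
        ((hSθintx N).const_mul (T * T ^ (1 - θ))) measurableSet_Ioi (fun t _ => hgbd N t)
    rw [integral_const_mul] at hle
    have hN0 : (0 : ℝ) ≤ N := Nat.cast_nonneg N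
    calc (N : ℝ) * ∫ t in Ioi (a N), |g N t| ≤ (N : ℝ) * (T * T ^ (1 - θ) * ∫ t in Ioi (a N), S N t ^ θ) :=
          mul_le_mul_of_nonneg_left hle hN0
      _ = T * T ^ (1 - θ) * τ N := by simp only [hτdef]; ring
  have hbf : Tendsto (fun N => L * τ N) atTop (𝓝 0) := by simpa using hτlim.const_mul L
  have hbg : Tendsto (fun N => T * T ^ (1 - θ) * τ N) atTop (𝓝 0) := by
    simpa using hτlim.const_mul (T * T ^ (1 - θ))
  -- window bounds (causality): |f| ≤ 2ε_N and |g| ≤ ε_N on (0, N^η]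
  have hwinf : ∀ (N : ℕ) (t : ℝ), 0 < t → t ≤ a N → |f N t| ≤ 2 * ε N := by
    intro N t ht hta
    have hw := hwin N t ht.le hta
    have h2 : (0:ℝ) ≤ 2 * (r N t) ^ 2 := by positivity
    calc |f N t| ≤ |P N t| + |2 * (r N t) ^ 2| := abs_sub _ _
      _ = |P N t| + 2 * (r N t) ^ 2 := by rw [abs_of_nonneg h2]
      _ ≤ 2 * (|P N t| + (r N t) ^ 2) := by linarith [abs_nonneg (P N t)]
      _ ≤ 2 * ε N := by linarith
  have hwing : ∀ (N : ℕ) (t : ℝ), 0 < t → t ≤ a N → |g N t| ≤ ε N := by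
    intro N t ht hta
    have hw := hwin N t ht.le hta
    simp only [hgdef, abs_of_nonneg (sq_nonneg (r N t))]
    linarith [abs_nonneg (P N t)]
  -- window masses: N · (level × length) → 0
  have hNa : ∀ N : ℕ, (N : ℝ) * a N = (N : ℝ) ^ (1 + η) := by
    intro N
    simp only [hadef]
    rw [Real.rpow_add' (Nat.cast_nonneg N) (by linarith : (1:ℝ) + η ≠ 0), Real.rpow_one]
  have hwf : Tendsto (fun N : ℕ => (N : ℝ) * (2 * ε N * a N)) atTop (𝓝 0) := by
    have := hε.const_mul 2
    rw [mul_zero] at this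
    refine this.congr (fun N => ?_)
    rw [← hNa N]; ring
  have hwg : Tendsto (fun N : ℕ => (N : ℝ) * (ε N * a N)) atTop (𝓝 0) := by
    refine hε.congr (fun N => ?_)
    rw [← hNa N]; ring
  -- assemble with the abstract two-horizons lemma (landed, `TwoHorizonsMean`)
  refine ⟨hfint, ?_, hgint, ?_⟩
  · exact twoHorizons_tendsto_mul_integral_of_window_tail ha0 hfint hwinf htailf hwf hbf
  · exact twoHorizons_tendsto_mul_integral_of_window_tail ha0 hgint hwing htailg hwg hbg

/-- **The registered envelope implies the forecast tail** (one parameter point, every coupling): if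
`S_N(t) ≤ C(1+t)^{−α}` for all `N`, `t ≥ 0` with `α > 2`, then `FT` holds with `θ = η = (α+2)/(2α)`:
`S_N^θ ≤ C^θ(1+t)^{−αθ}` is integrable (`αθ > 1`) and `N∫_{t>N^θ} S_N^θ ≤ C^θ/(αθ−1)·N^{(2−α)/4} → 0`. [folklore] -/
theorem forecastTailAt_of_forecastEnvelopeAt {ω₂ lam β γ T : ℝ} (hω : 0 < ω₂) (hl : 0 ≤ lam) (hβ : 0 ≤ β)
    (hγ : 0 ≤ γ) (hT : 0 < T)
    (henv : ∃ C α : ℝ, 2 < α ∧ ∀ (N : ℕ) (t : ℝ), 0 ≤ t → fnorm ω₂ lam β γ T N t ≤ C * (1 + t) ^ (-α)) :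
    ∃ θ η : ℝ, 0 < θ ∧ θ < 1 ∧ 0 < η ∧ η < 1 ∧
      (∀ N : ℕ, IntegrableOn (fun t => (fnorm ω₂ lam β γ T N t) ^ θ) (Ioi (0 : ℝ))) ∧
      Tendsto (fun N : ℕ => (N : ℝ) * ∫ t in Ioi ((N : ℝ) ^ η), (fnorm ω₂ lam β γ T N t) ^ θ) atTop (𝓝 0) := by
  obtain ⟨C, α, hα, hS⟩ := henv
  set θ : ℝ := (α + 2) / (2 * α) with hθdef
  have hα0 : 0 < α := by linarith
  have hθ0 : 0 < θ := by rw [hθdef]; positivity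
  have hθ1 : θ < 1 := by
    rw [hθdef, div_lt_one (by positivity)]; linarith
  have hαθ : α * θ = (α + 2) / 2 := by rw [hθdef]; field_simp
  have hαθ1 : 1 < α * θ := by rw [hαθ]; linarith
  have he1 : 1 + θ * (1 - α * θ) = (2 - α) / 4 := by rw [hθdef]; field_simp; ring
  have he1neg : 1 + θ * (1 - α * θ) < 0 := by
    rw [he1]; exact div_neg_of_neg_of_pos (by linarith) (by norm_num)
  set S : ℕ → ℝ → ℝ := fun N t => fnorm ω₂ lam β γ T N t with hSdef
  have hS0 : ∀ N t, 0 ≤ S N t := fun N t => fnorm_nonneg ω₂ lam β γ T N t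
  have hC0 : 0 ≤ C := by
    have h := hS 0 0 le_rfl
    simp only [add_zero, Real.one_rpow, mul_one] at h
    exact (hS0 0 0).trans h
  have h1t : ∀ t : ℝ, 0 ≤ t → 0 ≤ (1 + t) ^ (-α) := fun t ht => Real.rpow_nonneg (by linarith) _
  have hSθ : ∀ (N : ℕ) (t : ℝ), 0 ≤ t → S N t ^ θ ≤ C ^ θ * (1 + t) ^ (-(α * θ)) := by
    intro N t ht
    calc S N t ^ θ ≤ (C * (1 + t) ^ (-α)) ^ θ :=
          Real.rpow_le_rpow (hS0 N t) (hS N t ht) hθ0.le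
      _ = C ^ θ * (1 + t) ^ (-(α * θ)) := by
          rw [Real.mul_rpow hC0 (h1t t ht), ← Real.rpow_mul (by linarith : (0:ℝ) ≤ 1 + t), neg_mul]
  set G : ℝ → ℝ := fun t => C ^ θ * (1 + t) ^ (-(α * θ)) with hGdef
  have hGint : IntegrableOn G (Ioi (0 : ℝ)) := (twoHorizons_integrableOn_one_add_rpow_neg hαθ1).const_mul _
  have hSmeas : ∀ N, Measurable (S N) := fun N => commonPastBound_measurable_fnorm hω hl hβ hγ hT N
  have hSθint : ∀ N : ℕ, IntegrableOn (fun t => S N t ^ θ) (Ioi (0 : ℝ)) := by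
    intro N
    refine Integrable.mono' hGint ((hSmeas N).pow_const θ).aestronglyMeasurable ?_
    refine (ae_restrict_iff' measurableSet_Ioi).2 (ae_of_all _ fun t (ht : 0 < t) => ?_)
    rw [Real.norm_eq_abs, abs_of_nonneg (Real.rpow_nonneg (hS0 N t) θ)]
    exact hSθ N t ht.le
  refine ⟨θ, θ, hθ0, hθ1, hθ0, hθ1, hSθint, ?_⟩
  -- the tail: N ∫_{Ioi N^θ} S^θ ≤ C^θ/(αθ-1) · N^{1+θ(1-αθ)} → 0, and it is ≥ 0
  have hapos : ∀ N : ℕ, 1 ≤ N → 0 < (N : ℝ) ^ θ := fun N hN =>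
    Real.rpow_pos_of_pos (by exact_mod_cast Nat.lt_of_lt_of_le Nat.zero_lt_one hN) θ
  have hpow : ∀ (N : ℕ), 1 ≤ N → ∀ s : ℝ, (N : ℝ) * ((N : ℝ) ^ θ) ^ (1 - s) = (N : ℝ) ^ (1 + θ * (1 - s)) := by
    intro N hN s
    have hNpos : (0 : ℝ) < N := by exact_mod_cast Nat.lt_of_lt_of_le Nat.zero_lt_one hN
    rw [← Real.rpow_mul hNpos.le, Real.rpow_add hNpos, Real.rpow_one]
  set b : ℕ → ℝ := fun N => C ^ θ / (α * θ - 1) * (N : ℝ) ^ (1 + θ * (1 - α * θ)) with hbdef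
  have hblim : Tendsto b atTop (𝓝 0) := by
    have := (twoHorizons_tendsto_natCast_rpow_of_neg he1neg).const_mul (C ^ θ / (α * θ - 1))
    simpa [hbdef] using this
  have hnonneg : ∀ N : ℕ, 0 ≤ (N : ℝ) * ∫ t in Ioi ((N : ℝ) ^ θ), S N t ^ θ := fun N =>
    mul_nonneg (Nat.cast_nonneg N) (setIntegral_nonneg measurableSet_Ioi fun t _ => Real.rpow_nonneg (hS0 N t) θ)
  have hle : ∀ᶠ N : ℕ in atTop, (N : ℝ) * ∫ t in Ioi ((N : ℝ) ^ θ), S N t ^ θ ≤ b N := by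
    filter_upwards [eventually_ge_atTop 1] with N hN
    have hx := hapos N hN
    have hGx : IntegrableOn G (Ioi ((N : ℝ) ^ θ)) := hGint.mono_set (Ioi_subset_Ioi hx.le)
    have h1 : ∫ t in Ioi ((N : ℝ) ^ θ), S N t ^ θ ≤ ∫ t in Ioi ((N : ℝ) ^ θ), G t :=
      setIntegral_mono_on ((hSθint N).mono_set (Ioi_subset_Ioi hx.le)) hGx measurableSet_Ioi
        (fun t ht => hSθ N t (hx.le.trans (le_of_lt ht)))
    have h2 : ∫ t in Ioi ((N : ℝ) ^ θ), G t ≤ C ^ θ * (((N : ℝ) ^ θ) ^ (1 - α * θ) / (α * θ - 1)) := by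
      simp only [hGdef]
      rw [integral_const_mul]
      exact mul_le_mul_of_nonneg_left (twoHorizons_setIntegral_Ioi_one_add_rpow_le hαθ1 hx) (by positivity)
    have hN0 : (0 : ℝ) ≤ N := Nat.cast_nonneg N
    calc (N : ℝ) * ∫ t in Ioi ((N : ℝ) ^ θ), S N t ^ θ
        ≤ (N : ℝ) * (C ^ θ * (((N : ℝ) ^ θ) ^ (1 - α * θ) / (α * θ - 1))) :=
          mul_le_mul_of_nonneg_left (h1.trans h2) hN0
      _ = C ^ θ / (α * θ - 1) * ((N : ℝ) * ((N : ℝ) ^ θ) ^ (1 - α * θ)) := by ring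
      _ = b N := by rw [hpow N hN (α * θ)]
  exact squeeze_zero' (Eventually.of_forall hnonneg) hle hblim

/-! ## The line's compositions re-based on the tail (all parameters `> 0`) -/

/-- **The forecast tail closes the rank-2 crux `CoherentDephasing` BY NAME** (weaker hypothesis than the registered
envelope `stub_forecastLoss`, cf. `coherentDephasing_of_forecastLoss`). CONDITIONAL on the tail. [folklore] -/
theorem coherentDephasing_of_forecastTail : (∀ ω₂ lam β γ : ℝ, 0 < ω₂ → 0 < lam → 0 < β → 0 < γ → ∀ T : ℝ, 0 < T → ∃ θ η : ℝ, 0 < θ ∧ θ < 1 ∧ 0 < η ∧ η < 1 ∧ (∀ N : ℕ, IntegrableOn (fun t => (fnorm ω₂ lam β γ T N t) ^ θ) (Ioi (0 : ℝ))) ∧ Tendsto (fun N : ℕ => (N : ℝ) * ∫ t in Ioi ((N : ℝ) ^ η), (fnorm ω₂ lam β γ T N t) ^ θ) atTop (𝓝 0)) → Summit.AtomisticToContinuum.FouriersLaw.Theses.PhononMeanFreePath.CoherentDephasing := by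
  intro hFT ω₂ lam β γ hω hl hβ hγ T hT
  obtain ⟨-, -, hrint, hrlim⟩ := forecastTailAt_meanChannels hω hl.le hβ.le hγ.le hT (hFT ω₂ lam β γ hω hl hβ hγ T hT)
  exact ⟨hrint, hrlim⟩

/-- **`IncoherentChannel` BY NAME from the forecast tail and the variance-channel limit** (cf.
`incoherentChannel_of_forecastLoss_of_varianceLimit`; the fixed-`N` integrability of `B_N` is landed). CONDITIONAL
on both hypotheses; the second is transport-strength. [folklore] -/
theorem incoherentChannel_of_forecastTail_of_varianceLimit : (∀ ω₂ lam β γ : ℝ, 0 < ω₂ → 0 < lam → 0 < β → 0 < γ → ∀ T : ℝ, 0 < T → ∃ θ η : ℝ, 0 < θ ∧ θ < 1 ∧ 0 < η ∧ η < 1 ∧ (∀ N : ℕ, IntegrableOn (fun t => (fnorm ω₂ lam β γ T N t) ^ θ) (Ioi (0 : ℝ))) ∧ Tendsto (fun N : ℕ => (N : ℝ) * ∫ t in Ioi ((N : ℝ) ^ η), (fnorm ω₂ lam β γ T N t) ^ θ) atTop (𝓝 0)) → (∀ ω₂ lam β γ : ℝ, 0 < ω₂ → 0 < lam → 0 < β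 → 0 < γ → ∀ T : ℝ, 0 < T → ∃ κ : ℝ, 0 < κ ∧ Tendsto (fun N : ℕ => (N : ℝ) * (γ ^ 2 / T ^ 2) * ∫ t in Ioi (0 : ℝ), varianceChannel ω₂ lam β γ T N t) atTop (𝓝 κ)) → Summit.AtomisticToContinuum.FouriersLaw.Theses.PhononMeanFreePath.IncoherentChannel := by
  intro hFT h₄ ω₂ lam β γ hω hl hβ hγ T hT
  obtain ⟨κ, hκ, hBlim⟩ := h₄ ω₂ lam β γ hω hl hβ hγ T hT
  have hBint := varianceTransport_integrableOn ω₂ lam β γ hω hl hβ hγ T hT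
  obtain ⟨hMint, hMlim, -, -⟩ :=
    forecastTailAt_meanChannels hω hl.le hβ.le hγ.le hT (hFT ω₂ lam β γ hω hl hβ hγ T hT)
  exact ⟨κ, hκ, twoHorizons_cruxSeq_tendsto_of_split hBint hBlim hMint hMlim⟩

/-- **Under the forecast tail alone the crux IS the conjunct**: `FT → (IncoherentChannel ↔ FouriersLaw)` (the tail
gives `CoherentDephasing`; then the landed `LoadBearing.incoherentChannel_iff_fouriersLaw` over the proved siblings
`NessUnique_holds`, `boundaryKubo_proof`). [folklore] -/
theorem incoherentChannel_iff_fouriersLaw_of_forecastTail : (∀ ω₂ lam β γ : ℝ, 0 < ω₂ → 0 < lam → 0 < β → 0 < γ → ∀ T : ℝ, 0 < T → ∃ θ η : ℝ, 0 < θ ∧ θ < 1 ∧ 0 < η ∧ η < 1 ∧ (∀ N : ℕ, IntegrableOn (fun t => (fnorm ω₂ lam β γ T N t) ^ θ) (Ioi (0 : ℝ))) ∧ Tendsto (fun N : ℕ => (N : ℝ) * ∫ t in Ioi ((N : ℝ) ^ η), (fnorm ω₂ lam β γ T N t) ^ θ) atTop (𝓝 0)) → (Summit.AtomisticToContinuum.FouriersLaw.Theses.PhononMeanFreePath.IncoherentChannel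 ↔ _root_.FouriersLaw) := fun hFT =>
  Summit.AtomisticToContinuum.FouriersLaw.Theorems.IncoherentChannel.Negative.LoadBearing.incoherentChannel_iff_fouriersLaw
    NessUnique_holds Summit.AtomisticToContinuum.FouriersLaw.Theorems.PhononMeanFreePathBoundaryKubo.boundaryKubo_proof
    (coherentDephasing_of_forecastTail hFT)

/-! ## Calibration: the tail is still false at the harmonic corner -/

/-- **The forecast tail is FALSE at `lam = β = 0`** (`ω₂, γ, T > 0`): it would close the coherent channel of the
pinned HARMONIC chain (`forecastTailAt_meanChannels` at the corner), against `HarmonicCoherentPersistence`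
(`harmonicCoherentPersistence_proof`: the Rieder–Lebowitz–Lieb ballistic conductance). So the weakening from the
pointwise envelope to the integrated tail does not cross the harmonic obstruction. [folklore] -/
theorem forecastTail_false_harmonic : ∀ ω₂ γ : ℝ, 0 < ω₂ → 0 < γ → ∀ T : ℝ, 0 < T → ¬ (∃ θ η : ℝ, 0 < θ ∧ θ < 1 ∧ 0 < η ∧ η < 1 ∧ (∀ N : ℕ, IntegrableOn (fun t => (fnorm ω₂ 0 0 γ T N t) ^ θ) (Ioi (0 : ℝ))) ∧ Tendsto (fun N : ℕ => (N : ℝ) * ∫ t in Ioi ((N : ℝ) ^ η), (fnorm ω₂ 0 0 γ T N t) ^ θ) atTop (𝓝 0)) := by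
  intro ω₂ γ hω hγ T hT htail
  have hlim := (forecastTailAt_meanChannels hω le_rfl le_rfl hγ.le hT htail).2.2.2
  refine (Summit.AtomisticToContinuum.FouriersLaw.Theorems.HarmonicCoherentPersistence.harmonicCoherentPersistence_proof
    ω₂ γ hω hγ T hT).2 ?_
  simpa only [pairCorr, fcast] using hlim

end Summit.AtomisticToContinuum.FouriersLaw.Theorems.PhononMeanFreePath

end
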